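import Mathlib
import HarnessLib
import Summits.Langlands.Langlands.Theses.SkinnerWilesDefectOne

/-!
# `ReducibleOrdinaryProModular` (stmt-Langlands-12919) — Negative knowledge I: level and ramification

From the standing disprover's `Cruxes/ReducibleOrdinaryProModular/Disproof.lean` (cdisprove cycle 1), the
unconditional part of the load-bearing analysis of the crux's conclusion
`∃ 𝒰 : TameLevel 2 F p, 𝒰.IsPadicallyAutomorphic ρ`:

* `isPadicallyAutomorphic_iff`, `heckeFrobPoly_two` — the conclusion unfolded to atoms (what a proof
  must construct: a continuous point `x` of `𝕋(𝒰)` with `tr ρ(Frob_v) = x(T_{v,1})`,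
  `det ρ(Frob_v) = q_v x(T_{v,2})` off `bad`);
* `bad_of_not_isUnramifiedAt`, `ae_isUnramifiedAt_of_isPadicallyAutomorphic` — the conclusion IMPLIES
  the crux's hypothesis "unramified almost everywhere" (so that hypothesis is free, and dropping it changes
  the statement exactly by infinitely ramified representations, cf. Ramakrishna, Ann. of Math. 151
  (2000), doi:10.2307/121048);
* `not_isPadicallyAutomorphic_full` — the natural strengthening "`𝒰 :=` the full level" fails for every
  `ρ` ramified at a place away from `p`;
* `exists_isPadicallyAutomorphic_bad_eq` — `p`-adic automorphy is upward closed in `bad` (same level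
  subgroup), so WLOG `bad` is any finite set containing the ramification and the places above `p`.

Imports the route file only for the vocabulary cone; no statement of the route is used. [folklore]
-/

namespace Summit.Langlands.Langlands.Theorems.ReducibleOrdinaryProModular.Negative

open Literature.NumberTheory.GaloisRepresentations
open Literature.NumberTheory.Automorphic
open Literature.NumberTheory.Automorphic.BigHeckeGLn
open IsDedekindDomain Filter Polynomial
open scoped NumberField

variable {n : ℕ} {F : Type} [Field F] [NumberField F] {p : ℕ} [Fact p.Prime]
variable {A : Type*} [CommRing A] [TopologicalSpace A]

/-- `𝒰.IsPadicallyAutomorphic ρ` unfolded: a CONTINUOUS ring homomorphism `x : 𝕋(𝒰) → A` with, for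
every good place `v ∉ 𝒰.bad`, `ρ` unramified at `v` and
`charpoly ρ(Frob_v) = heckeFrobPoly n q_v (x ∘ T_{v,·})` (arithmetic Frobenius). [folklore] -/
theorem isPadicallyAutomorphic_iff (𝒰 : TameLevel n F p) (ρ : FramedGaloisRep F A n) :
    𝒰.IsPadicallyAutomorphic ρ ↔
      ∃ x : CompletedCohomologyHeckeAlgebraGLn 𝒰 →+* A, Continuous x ∧
        ∀ v ∉ 𝒰.bad, ρ.IsUnramifiedAt v ∧
          ρ.HasFrobCharpolyAt v
            (heckeFrobPoly n (Ideal.absNorm v.asIdeal) fun i => x (𝒰.heckeT v i)) :=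
  Iff.rfl

/-- The rank-two Hecke–Frobenius polynomial is `X² − a₁ X + q a₂`. [folklore] -/
theorem heckeFrobPoly_two {R : Type*} [CommRing R] (q : ℕ) (a : ℕ → R) :
    heckeFrobPoly 2 q a = X ^ 2 - C (a 1) * X + C ((q : R) * a 2) := by
  have h : Finset.Icc 1 2 = {1, 2} := by decide
  rw [heckeFrobPoly, h, Finset.sum_insert (by decide), Finset.sum_singleton]
  norm_num
  abel

/-- A place where `ρ` ramifies is a bad place of ANY tame level at which `ρ` is `p`-adically
automorphic (`bad ⊇` ramification set). [folklore] -/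
theorem bad_of_not_isUnramifiedAt (𝒰 : TameLevel n F p) (ρ : FramedGaloisRep F A n)
    (h : 𝒰.IsPadicallyAutomorphic ρ) {v : HeightOneSpectrum (𝓞 F)}
    (hv : ¬ ρ.IsUnramifiedAt v) : v ∈ 𝒰.bad := by
  obtain ⟨x, -, hx⟩ := h
  by_contra hvb
  exact hv (hx v hvb).1

/-- **`p`-adic automorphy of some tame level forces unramifiedness almost everywhere** (`bad` is
finite): the crux's hypothesis `∀ᶠ v in cofinite, ρ.IsUnramifiedAt v` is implied by its conclusion.
[folklore] -/
theorem ae_isUnramifiedAt_of_isPadicallyAutomorphic (𝒰 : TameLevel n F p)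
    (ρ : FramedGaloisRep F A n) (h : 𝒰.IsPadicallyAutomorphic ρ) :
    ∀ᶠ v in cofinite, ρ.IsUnramifiedAt v := by
  rw [Filter.eventually_cofinite]
  exact 𝒰.bad_finite.subset fun v hv => bad_of_not_isUnramifiedAt 𝒰 ρ h hv

/-- **The level cannot be the full level**: at `TameLevel.full n F p` (`bad = {v ∣ p}`) no `ρ`
ramified at a place `v ∤ p` is `p`-adically automorphic. [folklore] -/
theorem not_isPadicallyAutomorphic_full (ρ : FramedGaloisRep F A n) {v : HeightOneSpectrum (𝓞 F)}
    (hv : (p : 𝓞 F) ∉ v.asIdeal) (hram : ¬ ρ.IsUnramifiedAt v) :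
    ¬ (TameLevel.full n F p).IsPadicallyAutomorphic ρ := fun h =>
  hv (bad_of_not_isUnramifiedAt (TameLevel.full n F p) ρ h hram)

/-- **`p`-adic automorphy is upward closed in `bad`.** Keeping the level subgroup `U` and declaring a
larger finite set `T ⊇ 𝒰.bad` bad gives again an `S`-good tame level, whose big Hecke algebra is a
closed subring of `𝕋(𝒰)` in the common product ring; restricting the point along the inclusion
preserves continuity and association off `T`. Hence WLOG `bad` is any finite set containing the
ramification of `ρ` and the places above `p`. [folklore] -/
theorem exists_isPadicallyAutomorphic_bad_eq (𝒰 : TameLevel n F p)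
    (T : Set (HeightOneSpectrum (𝓞 F))) (hT : T.Finite) (hle : 𝒰.bad ⊆ T)
    (ρ : FramedGaloisRep F A n) (h : 𝒰.IsPadicallyAutomorphic ρ) :
    ∃ 𝒰' : TameLevel n F p, 𝒰'.bad = T ∧ 𝒰'.subgroup = 𝒰.subgroup ∧ 𝒰'.IsPadicallyAutomorphic ρ := by
  let 𝒰' : TameLevel n F p :=
    { subgroup := 𝒰.subgroup
      bad := T
      bad_finite := hT
      mem_bad_of_mem := fun v hv => hle (𝒰.mem_bad_of_mem v hv)
      isOpen := 𝒰.isOpen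
      isCompact := 𝒰.isCompact
      le_glFiniteIntegralLevel := 𝒰.le_glFiniteIntegralLevel
      ofLocal_mem := fun v hv g hg => 𝒰.ofLocal_mem v (fun h => hv (hle h)) g hg
      mul_ofLocal_inv_mem := fun v hv u hu => 𝒰.mul_ofLocal_inv_mem v (fun h => hv (hle h)) u hu }
  refine ⟨𝒰', rfl, rfl, ?_⟩
  obtain ⟨x, hx, hass⟩ := h
  -- fewer good places, fewer generators; same tower, same operators
  have hgen : 𝒰'.heckeGenerators ⊆ 𝒰.heckeGenerators := by
    rintro y (⟨v, hv, i, rfl⟩ | ⟨v, hv, rfl⟩)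
    · exact Or.inl ⟨v, fun h => hv (hle h), i, rfl⟩
    · exact Or.inr ⟨v, fun h => hv (hle h), rfl⟩
  have hsub : 𝒰'.bigHeckeSubring ≤ 𝒰.bigHeckeSubring :=
    Subring.topologicalClosure_mono (Subring.closure_mono hgen)
  have hcont : Continuous (Subring.inclusion hsub) := by
    refine continuous_induced_rng.2 ?_
    have hval : Continuous (Subtype.val : 𝒰'.bigHeckeSubring → 𝒰'.bigEnd) :=
      continuous_subtype_val
    convert hval using 1
    funext y
    exact Subring.coe_inclusion hsub y
  refine ⟨x.comp (Subring.inclusion hsub), hx.comp hcont, fun v hv => ?_⟩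
  have hvb : v ∉ 𝒰.bad := fun h => hv (hle h)
  obtain ⟨hunr, hchar⟩ := hass v hvb
  refine ⟨hunr, ?_⟩
  have key : ∀ i, x (Subring.inclusion hsub (𝒰'.heckeT v i)) = x (𝒰.heckeT v i) := by
    intro i
    congr 1
    apply Subtype.ext
    rw [Subring.coe_inclusion, 𝒰'.coe_heckeT hv i, 𝒰.coe_heckeT hvb i]
    rfl
  have e : (fun i => (x.comp (Subring.inclusion hsub)) (𝒰'.heckeT v i)) =
      fun i => x (𝒰.heckeT v i) := funext key
  convert hchar using 3
  exact e

end Summit.Langlands.Langlands.Theorems.ReducibleOrdinaryProModular.Negative
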